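import Summits.QuantumFields.YangMills.Theorems.PoincareLipschitzSobolevChainRule
import Mathlib.Analysis.InnerProductSpace.PiL2
import HarnessLib

/-!
# Crux `BlockLipschitzL` (stmt-QuantumFields-23533) ∕ `HistoryTailL` (stmt-QuantumFields-19936), LINE 25 «CompactnessTransfer»,
# S1″ row (C) — (C)-PROOF brick (C-b-β) «THE WEAK CHAIN RULE BY EVENTUALLY-CONSTANT SMOOTH APPROXIMATION OF THE OUTER MAP»

Cell `ym3-torus` (YM ladder rung R3 = continuum SU(2) Yang–Mills on T³ — a RUNG, NOT the Clay problem: not d = 4, not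
infinite volume, not a mass gap); WIDTH helper seat `ym-ust-19936-w3` g15, brick (C-b-β) of the (C)-PROOF lineage project of seat
w2 g13 (LEAD ★w1-19936 g10 «GO (C)-PROOF»: discharge the named fact `Literature.Analysis.PDE.MinimisingMapCompactness` via the
Hardt–Kinderlehrer–Lin sphere projection; (C-b) = «HKL PROJECTION IN `W^{1,2}`» = (C-b-α) ray-projection calculus (px22 g7) ⊕ (C-b-β)
this file).  Helper `--supports stmt-QuantumFields-23533`; THEOREMS ONLY (0 `def`, 0 `sorry`, default heartbeats); imports w2 g13's
✓(CR) `…PoincareLipschitzSobolevChainRule` (`hasWeakFDerivOn_comp_of_fderiv_bounded`, the nonlinear chain rule for a smooth outer map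
with bounded derivative) + Mathlib.

THE BRICK.  The HKL ray projection `π_p` is smooth off its centre `p` only, with `‖Dπ_p(y)‖ ≲ ‖y − p‖⁻¹`; to compose it with a Sobolev
map `w` one approximates it by globally smooth maps `N_n` with bounded derivatives which AGREE WITH `π_p` (values and derivatives)
off shrinking balls around `p` and are CONSTANT `= p` on them — so that at every point `y` (the centre included, with Lean's junk
values `π_p p = p`, `fderiv ℝ π_p p = 0`) the sequences `N_n y`, `D N_n y` are EVENTUALLY CONSTANT.  This file proves the abstract
passage to the limit: if `w` has weak gradient `Gw` on `Ω`, the `N_n` are smooth with `‖D N_n‖ ≤ C_n`, `‖N_n‖ ≤ B`, eventually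
constant pointwise limits `P`, `D P`, and a common majorant `‖D N_n y‖ ≤ M y` with `M(w)·‖Gw‖` locally integrable on `Ω`, then
`P ∘ w` has weak gradient `D P(w) ∘ Gw` on `Ω` — by ✓(CR) for each `n` and DOMINATED CONVERGENCE on both sides of the test identity
(no weak compactness, no Stampacchia-type hypothesis on the fibre `{w = p}`; remark (α) of px22 g7 14:19:19Z).
[EvansGariepy1992 §4.2.2 Thm 4 (ii); Ziemer1989 Thm 2.1.11 — the chain rule; the approximation device is Hardt–Kinderlehrer–Lin 1986 §2.]

WHAT IS PROVED (ns `…Theorems.PoincareLipschitzSobolevChainRuleByApproximation`; generic: `E` f.d. real inner-product Borel,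
`μ` additive Haar, `F` complete, `F′` real normed).
* §1 `tendsto_of_eventually_eq`, `aestronglyMeasurable_clm_apply`.
* §2 ★★★ `hasWeakFDerivOn_comp_of_eventuallyEq_approx (hw) (hN) (hNC) (hNB) (hNP) (hNP′) (hM) (hInt) :
  HasWeakFDerivOn Ω μ (fun x => P (w x)) (fun x => (fderiv ℝ P (w x)).comp (Gw x))`.
* §3 ★★ `sum_norm_sq_comp_apply_le` — the density row `Σᵢ‖(D P(w x) ∘ Gw x) eᵢ‖² ≤ (M′(w x))²·Σᵢ‖Gw x eᵢ‖²` under `‖D P y‖ ≤ M′ y`.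
HONEST SCOPE.  A generic Sobolev brick; (C) = `MinimisingMapCompactness` is NOT proved here; the instantiation at `π_p` waits for
(C-b-α); (RS), S1″ (unconditionally), S2♭″, `hHalvingBand`, K1, `MeanDeviationL`, `BlockLipschitzL`, `HistoryTailL` NOT proved.
YM₃ on T³ is rung R3, not Clay; YM gap NOT proved; no summit statement is proved here.

References: L. C. Evans, R. F. Gariepy, Measure Theory and Fine Properties of Functions (1992) [EvansGariepy1992] (§4.2.2 Thm 4 (ii));
W. P. Ziemer, Weakly Differentiable Functions (1989) [Ziemer1989] (Thm 2.1.11); R. Hardt, D. Kinderlehrer, F.-H. Lin,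
Comm. Math. Phys. 105 (1986) [HardtKinderlehrerLin1986] (§2).
-/

set_option autoImplicit false


noncomputable section

open MeasureTheory Set Function Filter Topology Metric TopologicalSpace
open scoped ContDiff ENNReal BigOperators

namespace Summit.QuantumFields.YangMills.Theorems.PoincareLipschitzSobolevChainRuleByApproximation

open Literature.Analysis.FunctionSpaces
open Summit.QuantumFields.YangMills.Theorems.PoincareLipschitzWeakChainRuleShear (integrableOn_smul_of_locallyIntegrableOn)
open Summit.QuantumFields.YangMills.Theorems.PoincareLipschitzSobolevChainRule (hasWeakFDerivOn_comp_of_fderiv_bounded)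

variable {E : Type*} [NormedAddCommGroup E] [InnerProductSpace ℝ E] [FiniteDimensional ℝ E]
  [MeasurableSpace E] [BorelSpace E] {μ : Measure E} [μ.IsAddHaarMeasure]
variable {F : Type*} [NormedAddCommGroup F] [NormedSpace ℝ F] [CompleteSpace F]
variable {F' : Type*} [NormedAddCommGroup F'] [NormedSpace ℝ F']

/-! ## §1 Letters -/

omit [InnerProductSpace ℝ E] [FiniteDimensional ℝ E] [MeasurableSpace E] [BorelSpace E] [CompleteSpace F] in
/-- An eventually constant sequence converges. [folklore] -/
theorem tendsto_of_eventually_eq {X : Type*} [TopologicalSpace X] {a : ℕ → X} {b : X}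
    (h : ∀ᶠ n in atTop, a n = b) : Tendsto a atTop (𝓝 b) :=
  (tendsto_const_nhds (x := b)).congr' (h.mono fun _ hn => hn.symm)

omit [NormedAddCommGroup E] [InnerProductSpace ℝ E] [FiniteDimensional ℝ E] [BorelSpace E] [CompleteSpace F] in
/-- Applying a measurable operator field to a measurable vector field is measurable. [folklore] -/
theorem aestronglyMeasurable_clm_apply {ν : Measure E} {T : E → F →L[ℝ] F'} {y : E → F}
    (hT : AEStronglyMeasurable T ν) (hy : AEStronglyMeasurable y ν) :
    AEStronglyMeasurable (fun x => T x (y x)) ν := by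
  have := (ContinuousLinearMap.apply ℝ F').aestronglyMeasurable_comp₂ hy hT
  simpa only [ContinuousLinearMap.apply_apply] using this

/-! ## §2 The chain rule by eventually-constant smooth approximation -/

/-- ★★★ **WEAK CHAIN RULE BY SMOOTH APPROXIMATION OF THE OUTER MAP.**  Let `w` be weakly differentiable on `Ω` with weak gradient
`Gw`, and let `P : F → F′` be the pointwise EVENTUALLY-CONSTANT limit of smooth maps `N n` with globally bounded derivatives
(`‖D(N n)‖ ≤ C_n`), uniformly bounded values `‖N n y‖ ≤ B`, derivatives eventually equal to `fderiv ℝ P` pointwise, and a common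
majorant `‖D(N n) y‖ ≤ M y` with `x ↦ M (w x)·‖Gw x‖` locally integrable on `Ω`.  Then `P ∘ w` is weakly differentiable on `Ω` with
weak gradient `x ↦ D P(w x) ∘ Gw x` (the nonlinear chain rule ✓`hasWeakFDerivOn_comp_of_fderiv_bounded` for each `N n ∘ w`, then
dominated convergence on both sides of the test identity).  Typical use: `P` = the Hardt–Kinderlehrer–Lin ray projection `π_p`
(singular at `p`, junk values `π_p p = p`, `fderiv ℝ π_p p = 0`), `N n ≡ p` near `p`, `M y = K∕‖y − p‖`. [cite: EvansGariepy1992, §4.2.2 Thm 4 (ii); Ziemer1989, Thm 2.1.11] -/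
theorem hasWeakFDerivOn_comp_of_eventuallyEq_approx {Ω : Opens E} {w : E → F} {Gw : E → E →L[ℝ] F}
    (hw : HasWeakFDerivOn Ω μ w Gw) {P : F → F'} {N : ℕ → F → F'} (hN : ∀ n, ContDiff ℝ ∞ (N n))
    (hNC : ∀ n, ∃ C : ℝ, ∀ y, ‖fderiv ℝ (N n) y‖ ≤ C) {B : ℝ} (hNB : ∀ n y, ‖N n y‖ ≤ B)
    (hNP : ∀ y, ∀ᶠ n in atTop, N n y = P y) (hNP' : ∀ y, ∀ᶠ n in atTop, fderiv ℝ (N n) y = fderiv ℝ P y)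
    {M : F → ℝ} (hM : ∀ n y, ‖fderiv ℝ (N n) y‖ ≤ M y)
    (hInt : LocallyIntegrableOn (fun x => M (w x) * ‖Gw x‖) (Ω : Set E) μ) :
    HasWeakFDerivOn Ω μ (fun x => P (w x)) (fun x => (fderiv ℝ P (w x)).comp (Gw x)) := by
  have hΩlc : IsLocallyClosed (Ω : Set E) := Ω.isOpen.isLocallyClosed
  -- each `N n ∘ w` is weakly differentiable (the nonlinear chain rule)
  have hn : ∀ n, HasWeakFDerivOn Ω μ (fun x => N n (w x)) (fun x => (fderiv ℝ (N n) (w x)).comp (Gw x)) := by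
    intro n
    obtain ⟨C, hC⟩ := hNC n
    exact hasWeakFDerivOn_comp_of_fderiv_bounded hw (hN n) hC
  -- limits of the bounds
  have hPB : ∀ y, ‖P y‖ ≤ B := fun y => by
    obtain ⟨n, hn'⟩ := (hNP y).exists
    rw [← hn']; exact hNB n y
  have hPM : ∀ y, ‖fderiv ℝ P y‖ ≤ M y := fun y => by
    obtain ⟨n, hn'⟩ := (hNP' y).exists
    rw [← hn']; exact hM n y
  -- pointwise (everywhere) convergence of values and gradients
  have hlimP : ∀ x, Tendsto (fun n => N n (w x)) atTop (𝓝 (P (w x))) := fun x => tendsto_of_eventually_eq (hNP (w x))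
  have hlimD : ∀ x (e : E), Tendsto (fun n => ((fderiv ℝ (N n) (w x)).comp (Gw x)) e) atTop
      (𝓝 (((fderiv ℝ P (w x)).comp (Gw x)) e)) := fun x e => by
    refine tendsto_of_eventually_eq ((hNP' (w x)).mono fun n hn' => ?_)
    simp only [ContinuousLinearMap.comp_apply, hn']
  have hlimD' : ∀ x, Tendsto (fun n => (fderiv ℝ (N n) (w x)).comp (Gw x)) atTop
      (𝓝 ((fderiv ℝ P (w x)).comp (Gw x))) := fun x =>
    tendsto_of_eventually_eq ((hNP' (w x)).mono fun n hn' => by rw [hn'])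
  -- measurability of the limits on `Ω`
  have hmP : AEStronglyMeasurable (fun x => P (w x)) (μ.restrict Ω) :=
    aestronglyMeasurable_of_tendsto_ae atTop (fun n => (hn n).locallyIntegrableOn.aestronglyMeasurable)
      (Eventually.of_forall hlimP)
  have hmH : AEStronglyMeasurable (fun x => (fderiv ℝ P (w x)).comp (Gw x)) (μ.restrict Ω) :=
    aestronglyMeasurable_of_tendsto_ae atTop (fun n => (hn n).locallyIntegrableOn_deriv.aestronglyMeasurable)
      (Eventually.of_forall hlimD')
  refine ⟨?_, ?_, fun φ v hφ => ?_⟩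
  · -- local integrability of `P ∘ w` (bounded and measurable)
    rw [locallyIntegrableOn_iff hΩlc]
    intro K hK hKc
    refine Integrable.mono' (integrableOn_const (C := B) (hKc.measure_lt_top (μ := μ)).ne) (hmP.mono_measure
      (Measure.restrict_mono hK le_rfl)) (Eventually.of_forall fun x => hPB _)
  · -- local integrability of the gradient (dominated by `M(w)·‖Gw‖`)
    rw [locallyIntegrableOn_iff hΩlc]
    intro K hK hKc
    have hIK : IntegrableOn (fun x => M (w x) * ‖Gw x‖) K μ := hInt.integrableOn_compact_subset hK hKc
    refine Integrable.mono' hIK (hmH.mono_measure (Measure.restrict_mono hK le_rfl)) (Eventually.of_forall fun x => ?_)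
    exact (ContinuousLinearMap.opNorm_comp_le _ _).trans (mul_le_mul_of_nonneg_right (hPM _) (norm_nonneg _))
  · -- the test identity, by dominated convergence on both sides
    have hφc : Continuous φ := hφ.contDiff.continuous
    have hφ'c : Continuous fun x => fderiv ℝ φ x v := (hφ.contDiff.continuous_fderiv (by simp)).clm_apply continuous_const
    have hφ's : HasCompactSupport fun x => fderiv ℝ φ x v := hφ.hasCompactSupport.fderiv_apply (𝕜 := ℝ) v
    have idn : ∀ n, ∫ x in (Ω : Set E), (fderiv ℝ φ x v) • N n (w x) ∂μ =
        -∫ x in (Ω : Set E), φ x • ((fderiv ℝ (N n) (w x)).comp (Gw x)) v ∂μ :=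
      fun n => (hn n).integral_fderiv_smul_eq φ v hφ
    -- LHS → by dominated convergence (bound `‖∂ᵥφ‖·B`)
    have hL : Tendsto (fun n => ∫ x in (Ω : Set E), (fderiv ℝ φ x v) • N n (w x) ∂μ) atTop
        (𝓝 (∫ x in (Ω : Set E), (fderiv ℝ φ x v) • P (w x) ∂μ)) := by
      refine tendsto_integral_of_dominated_convergence (fun x => ‖fderiv ℝ φ x v‖ * B) ?_ ?_ ?_ ?_
      · intro n
        exact hφ'c.aestronglyMeasurable.smul (hn n).locallyIntegrableOn.aestronglyMeasurable
      · exact ((hφ'c.norm.mul continuous_const).integrable_of_hasCompactSupport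
          (hφ's.norm.mul_right)).integrableOn
      · intro n
        refine Eventually.of_forall fun x => ?_
        rw [norm_smul]
        exact mul_le_mul_of_nonneg_left (hNB n _) (norm_nonneg _)
      · exact Eventually.of_forall fun x => (hlimP x).const_smul _
    -- RHS → by dominated convergence (bound `‖φ‖·M(w)‖Gw‖‖v‖`, integrable on `Ω` because `tsupport φ ⊆ Ω` is compact)
    have hsupp : tsupport (fun x => ‖φ x‖ * ‖v‖) ⊆ (Ω : Set E) := by
      refine (closure_mono ?_).trans hφ.tsupport_subset
      intro x hx
      simp only [Function.mem_support, ne_eq, mul_eq_zero, norm_eq_zero, not_or] at hx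
      exact hx.1
    have hbound : IntegrableOn (fun x => (‖φ x‖ * ‖v‖) • (M (w x) * ‖Gw x‖)) (Ω : Set E) μ :=
      integrableOn_smul_of_locallyIntegrableOn hInt (hφc.norm.mul continuous_const)
        (hφ.hasCompactSupport.norm.mul_right) hsupp
    have hR : Tendsto (fun n => ∫ x in (Ω : Set E), φ x • ((fderiv ℝ (N n) (w x)).comp (Gw x)) v ∂μ) atTop
        (𝓝 (∫ x in (Ω : Set E), φ x • ((fderiv ℝ P (w x)).comp (Gw x)) v ∂μ)) := by
      refine tendsto_integral_of_dominated_convergence (fun x => (‖φ x‖ * ‖v‖) • (M (w x) * ‖Gw x‖)) ?_ hbound ?_ ?_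
      · intro n
        exact hφc.aestronglyMeasurable.smul
          (aestronglyMeasurable_clm_apply (hn n).locallyIntegrableOn_deriv.aestronglyMeasurable aestronglyMeasurable_const)
      · intro n
        refine Eventually.of_forall fun x => ?_
        rw [norm_smul, smul_eq_mul]
        have h1 : ‖((fderiv ℝ (N n) (w x)).comp (Gw x)) v‖ ≤ M (w x) * ‖Gw x‖ * ‖v‖ :=
          calc ‖((fderiv ℝ (N n) (w x)).comp (Gw x)) v‖ ≤ ‖(fderiv ℝ (N n) (w x)).comp (Gw x)‖ * ‖v‖ :=
                ContinuousLinearMap.le_opNorm _ _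
            _ ≤ ‖fderiv ℝ (N n) (w x)‖ * ‖Gw x‖ * ‖v‖ :=
                mul_le_mul_of_nonneg_right (ContinuousLinearMap.opNorm_comp_le _ _) (norm_nonneg _)
            _ ≤ M (w x) * ‖Gw x‖ * ‖v‖ := by
                refine mul_le_mul_of_nonneg_right ?_ (norm_nonneg _)
                exact mul_le_mul_of_nonneg_right (hM n _) (norm_nonneg _)
        calc ‖φ x‖ * ‖((fderiv ℝ (N n) (w x)).comp (Gw x)) v‖ ≤ ‖φ x‖ * (M (w x) * ‖Gw x‖ * ‖v‖) :=
              mul_le_mul_of_nonneg_left h1 (norm_nonneg _)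
          _ = ‖φ x‖ * ‖v‖ * (M (w x) * ‖Gw x‖) := by ring
      · exact Eventually.of_forall fun x => (hlimD x v).const_smul _
    have hR' := hR.neg
    have heq : (fun n => ∫ x in (Ω : Set E), (fderiv ℝ φ x v) • N n (w x) ∂μ) =
        fun n => -∫ x in (Ω : Set E), φ x • ((fderiv ℝ (N n) (w x)).comp (Gw x)) v ∂μ := funext idn
    rw [heq] at hL
    exact tendsto_nhds_unique hL hR'

/-! ## §3 The density row -/

omit [FiniteDimensional ℝ E] [MeasurableSpace E] [BorelSpace E] [CompleteSpace F] in
/-- ★★ **DENSITY OF THE COMPOSED GRADIENT.**  `Σᵢ‖(DP(w x) ∘ Gw x) eᵢ‖² ≤ (M′(w x))²·Σᵢ‖Gw x eᵢ‖²` whenever `‖DP y‖ ≤ M′ y`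
(any finite index family of directions). [folklore] -/
theorem sum_norm_sq_comp_apply_le {ι : Type*} (s : Finset ι) (e : ι → E) {w : E → F} {Gw : E → E →L[ℝ] F} {P : F → F'}
    {M' : F → ℝ} (hM' : ∀ y, ‖fderiv ℝ P y‖ ≤ M' y) (x : E) :
    ∑ i ∈ s, ‖((fderiv ℝ P (w x)).comp (Gw x)) (e i)‖ ^ 2 ≤ (M' (w x)) ^ 2 * ∑ i ∈ s, ‖Gw x (e i)‖ ^ 2 := by
  have hM0 : 0 ≤ M' (w x) := (norm_nonneg _).trans (hM' _)
  rw [Finset.mul_sum]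
  refine Finset.sum_le_sum fun i _ => ?_
  have h1 : ‖((fderiv ℝ P (w x)).comp (Gw x)) (e i)‖ ≤ M' (w x) * ‖Gw x (e i)‖ := by
    rw [ContinuousLinearMap.comp_apply]
    exact ((fderiv ℝ P (w x)).le_opNorm _).trans (mul_le_mul_of_nonneg_right (hM' _) (norm_nonneg _))
  calc ‖((fderiv ℝ P (w x)).comp (Gw x)) (e i)‖ ^ 2 ≤ (M' (w x) * ‖Gw x (e i)‖) ^ 2 :=
        pow_le_pow_left₀ (norm_nonneg _) h1 2
    _ = (M' (w x)) ^ 2 * ‖Gw x (e i)‖ ^ 2 := by ring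

end Summit.QuantumFields.YangMills.Theorems.PoincareLipschitzSobolevChainRuleByApproximation

end
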